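/-
Copyright (c) 2026 the pub-hodgecm-mathlib formalisation cell (harness21).  Prover seat hodgecm-mathlib-R90-C10-p03 (g0) (valve hand on strike line L1 ∕ KW),
Track B «K2-LIT», hLiu418 = stmt-HodgeConjecture-24832; socket #41, KIND W, (x-a-pres)(ii) — KW DESK F0P2-p08 (g3) `hpres` CENSUS RESULT 2026-09-05T00:12:26Z +
WORD 00:13:12Z (c): the archimedean CONTINUATION letter `hex` of ★ `K2LiuKindWArchLetterDefs` for an arch family PRESENTED AS A FINITE SUM of flat place-products read at a
TRANSLATED point, times a holomorphic scalar (★ FILE 18 `K2LiuArchFlatTubePresentation`'s output currency).  Sibling of ★ FILE A `K2LiuKindWArchContinuation` (LH4-p10).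
THEOREMS ONLY.
-/
import Summits.HodgeConjecture.HodgeConjecture.Theorems.K2LiuKindWArchLetterIntegrable   -- ★ (iii-arch-int) K2Liu-p11 p863408: §1 engine + ★ FILE A p863282 (§4, §5) + `continuous_unipDeltaChar`
import Summits.HodgeConjecture.HodgeConjecture.Theorems.K2LiuKindWArchLetterDefs         -- ★ LH4-p08 p863152: `archWhittakerIntegral`, the `hex` bytes
import HarnessLib

/-!
# Crux `HLiu418`, socket #41, KIND W, (x-a-pres)(ii): `hex` FROM A SUM-OF-FLAT-PRODUCTS PRESENTATION — `K2LiuKindWArchContinuationBridge`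

Cell `hodgecm-mathlib`, crux item hLiu418 = `stmt-HodgeConjecture-24832`; squad K2, strike line L1, KW desk F0P2-p08 (g3).  Lane `--supports stmt-HodgeConjecture-24832
--as helper` (count-neutral).  THEOREMS ONLY (no `def`, no instance, no notation, no named-fact hypothesis, no `sorry`, default heartbeats).

THE GAP NAMED BY THE KW DESK (00:12:26Z).  Both arch consumers — ★ `K2LiuKindWArchLetterIntegrable.hintArch_of_kindWArchLetter` and ★ FILE A
`K2LiuKindWArchContinuation.exists_continuation_twisted_of_presentation(')` — take a PURE place-product `Φ s a = ∏_w F_{s,w}(Fr a w)`; ★ FILE 18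
`K2LiuArchFlatTubePresentation.exists_flat_tube_presentation` presents the (KW-fac) arch factor as
  `Φ s a = Cst(s) · Σ_r c_r ∏_w G_{s,r,w}(Fr (a·g) w)`  — a finite SUM over `r`, a scalar `Cst(s) = H_𝒦(g⁻¹)^{2(s−s₀)}`, the frame read at the TRANSLATED point `a·g`,
with `G_{s,r,w} ∈ I_w(s, χ_{k_w})` flat of compact picture `Q_{r,w}`.  Both consumers are LINEAR; THIS FILE is head (ii), the continuation:
* §1 **`exists_continuation_archWhittakerIntegral_of_sumPresentation`** — frame letters of record `(T, Tinv, Fr, hFr, hT1, hT2, hTU, hTiv, hTN)`, the anti-diagonal reading `hBC`,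
  a Haar `ν` on `N_Δ(L⁺⊗ℝ)`, an index `S`, an arch point `g₀`, the frame reading `heb` of the character `conj ψ_S(ι_∞ ·) = ∏_w e_w((Fr · w)₁₂)`, the PER-`(r,w)` twisted letters
  `hW r w` at the point `Fr (g₀·g) w` on `{s₁ < re}` (★ FILE A §4's shape, BY VALUE: definite framed index ★ `K2LiuKindWArchWhittakerLetter`, indefinite = «Φ6b-ind»), and the
  sum presentation `(Cst, hCst, Gs, hGs, hGsQ, g, hpres)` on `{s₁ < re}`, `½ ≤ s₁` ⊢
  `∃ F, DifferentiableOn ℂ F {0 < re} ∧ ∀ s, s₁ < re s → F s = archWhittakerIntegral ν S Φ g₀ s`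
  — per `r` ★ FILE A §4 at the free right factor `g₀·g` (`(w_Δ·a·g₀)·g = w_Δ·a·(g₀·g)`, `mul_assoc` only, no multiplicativity of `Fr`), `F := Cst · Σ_r c_r E_r`
  (`DifferentiableOn.mul/fun_sum`), the identity by `integral_finsetSum` + `integral_const_mul` with per-term integrability ★ FILE A §5 (weight `conj ψ_S(ι_∞ ·)`
  continuous — ★ `continuous_unipDeltaChar` ∘ ★ `continuous_archToAdelic` — and unimodular, `Circle.norm_coe`; the (x-a-pres)(i) engine ★ p863408 §1's argument).
  With `s₁ := n∕2 = 2∕2` and `g₀ := h_∞` this IS ★ `K2LiuKindWArchLetterDefs`' `hex` at `(j, S, h)`.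
* §2 **`hex_of_sumPresentation`** — the `hex` slot of ★ `kindWArchLetter_eq_integral` VERBATIM at `n := 2` (`∀ j S h, det ↑S ≠ 0 → ∃ F, … ∀ s, (2:ℕ)∕2 < re s → F s =
  archWhittakerIntegral (νinf (kindWFinset T₀ ↑S h)) ↑S (FinfT j S h) h_∞ s`), from the per-`(j, S, h)` sum-presentation letter in its weakest (existential) form `hpresW`
  (binder order `j S h`; carriers `νinf T` Haar).
HONEST LABEL.  Count-neutral helper; it moves the KIND-W arch residue `hex` onto (a) the per-`(r,w)` twisted Whittaker letters and (b) the sum presentation of the (KW-fac)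
factors (★ FILE 18 + `hreadArch`), nothing more: `HC_CM` is proved only modulo the 7 printed citations (2 remaining named inputs: hLiu418 = `stmt-HodgeConjecture-24832`,
h413 = `stmt-HodgeConjecture-24833`) until rung 0 closes.

## References
* [Shimura1997] G. Shimura, *Euler Products and Eisenstein Series*, CBMS 93 (1997), §16.4, §18.4 (archimedean factors of the Fourier coefficients).
* [KudlaRallis1994] S. Kudla, S. Rallis, Ann. of Math. 140 (1994), §1–§2 (Euler factorisation of the Fourier coefficients of Siegel Eisenstein series).
* [MoeglinWaldspurger1995] C. Mœglin, J.-L. Waldspurger, *Spectral Decomposition and Eisenstein Series* (1995), II.1.5, IV.1.9.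
* [BorelJacquet1979] A. Borel, H. Jacquet, Proc. Symp. Pure Math. 33 (1979), §4.1.
-/

set_option autoImplicit false
set_option linter.dupNamespace false -- the mandated namespace repeats `HodgeConjecture.HodgeConjecture`

noncomputable section

open Complex Matrix MeasureTheory MeasureTheory.Measure NumberField IsDedekindDomain
open scoped ComplexConjugate NNReal
open Literature.NumberTheory.Automorphic Literature.NumberTheory.GelbartRogawski1991 Literature.NumberTheory.GelbartRogawski1991.GRConstruction
open Literature.NumberTheory.K2Lit.SiegelDoubled
open Summit.HodgeConjecture.HodgeConjecture.Cruxes.HLiu418.K2LiuArchInducedTubeDefs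
open Summit.HodgeConjecture.HodgeConjecture.Cruxes.HLiu418.K2LiuU22CompactPictureDefs
open Summit.HodgeConjecture.HodgeConjecture.Cruxes.HLiu418.K2LiuSiegelUnipotentLocalDefs (unipDeltaArch)
open Summit.HodgeConjecture.HodgeConjecture.Cruxes.HLiu418.K2LiuSiegelUnipotentFourierDefs (skewMatrices unipDeltaChar)
open Summit.HodgeConjecture.HodgeConjecture.Cruxes.HLiu418.K2LiuSiegelUnipotentCharacters (continuous_unipDeltaChar)
open Summit.HodgeConjecture.HodgeConjecture.Cruxes.HLiu418.K2LiuSiegelEisensteinKindWLetters (kindWFinset)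
open Summit.HodgeConjecture.HodgeConjecture.Cruxes.HLiu418.K2LiuKindWArchContinuation (exists_continuation_twisted_of_presentation integrable_twisted_prod_unipDeltaArch_of_record)
open Summit.HodgeConjecture.HodgeConjecture.Cruxes.HLiu418.K2LiuKindWArchLetterDefs (archWhittakerIntegral)

namespace Summit.HodgeConjecture.HodgeConjecture.Cruxes.HLiu418.K2LiuKindWArchContinuationBridge

variable (L : Type) [Field L] [NumberField L] [IsCMField L]
variable {N₀ M₀ : ℕ} (e : Fin N₀ × Fin M₀ ≃ Fin 2)
  (dV : Fin N₀ → L) (hdV : ∀ i, IsCMField.complexConj L (dV i) = dV i)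
  (dW : Fin M₀ → L) (hdW : ∀ i, IsCMField.complexConj L (dW i) = dW i)
  (T Tinv : {w : InfinitePlace L // w.IsComplex} → Matrix (Fin 2 ⊕ Fin 2) (Fin 2 ⊕ Fin 2) ℂ)
  (Fr : UnitaryGroup.arch (Fp L) L (IsCMField.complexConj L) (2 + 2) (hermD L e dV hdV dW hdW) →
    {w : InfinitePlace L // w.IsComplex} → Matrix (Fin 2 ⊕ Fin 2) (Fin 2 ⊕ Fin 2) ℂ)
  (hFr : ∀ a w, Fr a w = T w * Matrix.reindex (e₂ (n := 2)).symm (e₂ (n := 2)).symm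
    (((UnitaryGroup.archAt (Fp L) L (IsCMField.complexConj L) (2 + 2) (hermD L e dV hdV dW hdW) w
      (UnitaryGroup.complexConj_smul_infinitePlace L w.1) (IsCMField.complexConj_ne_one L) a :
        UnitaryGroup.archLocal L (2 + 2) (hermD L e dV hdV dW hdW) w) : GL (Fin (2 + 2)) ℂ) : Matrix (Fin (2 + 2)) (Fin (2 + 2)) ℂ) * Tinv w)
  (hT2 : ∀ w, Tinv w * T w = 1)
  (hTU : ∀ w (g : GL (Fin (2 + 2)) ℂ), g ∈ UnitaryGroup.archLocal L (2 + 2) (hermD L e dV hdV dW hdW) w →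
    (T w * Matrix.reindex (e₂ (n := 2)).symm (e₂ (n := 2)).symm (g : Matrix _ _ ℂ) * Tinv w)ᴴ * Matrix.J (Fin 2) ℂ *
      (T w * Matrix.reindex (e₂ (n := 2)).symm (e₂ (n := 2)).symm (g : Matrix _ _ ℂ) * Tinv w) = Matrix.J (Fin 2) ℂ)
  [MeasurableSpace ↥(unipDeltaArch L e dV hdV dW hdW)] [BorelSpace ↥(unipDeltaArch L e dV hdV dW hdW)]
  [Fintype {w : InfinitePlace L // w.IsComplex}]

/-! ## §1 One index, one Haar carrier, one point: the continuation of the arch Whittaker integral of a sum-presented family -/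

include hFr hT2 hTU in
/-- **THE ARCH WHITTAKER INTEGRAL OF A SUM-PRESENTED FAMILY CONTINUES TO `{0 < re s}`.**  Frame letters of record and `hBC` BY VALUE; a Haar `ν` on `N_Δ(L⁺⊗ℝ)`; an index
`S ∈ M₂(L)` with the frame reading `heb` of `conj ψ_S(ι_∞ ·)`; an arch point `g₀`; per `(r, w)` the twisted Whittaker letter `hW r w` at `Fr (g₀·g) w` on `{s₁ < re}` (★ FILE A
§4's shape); and an arch family `Φ` presented on `{s₁ < re}` as `Φ s a = Cst s · Σ_r c_r ∏_w Gs s r w (Fr (a·g) w)` with `Cst` holomorphic on `{0 < re}`, `Gs s r w ∈ I_w(s, χ_{k_w})`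
flat of compact picture `Q r w`; `½ ≤ s₁`.  THEN `∃ F, DifferentiableOn ℂ F {0 < re} ∧ ∀ s, s₁ < re s → F s = archWhittakerIntegral ν S Φ g₀ s`
(`F := Cst · Σ_r c_r E_r`, `E_r` from ★ FILE A §4 at the right factor `g₀·g`; the identity by `integral_finsetSum` ∕ `integral_const_mul`, per-term integrability ★ FILE A §5).
[cite: Shimura1997, §16.4, §18.4] [cite: KudlaRallis1994, §1–§2] [cite: MoeglinWaldspurger1995, II.1.5] -/
theorem exists_continuation_archWhittakerIntegral_of_sumPresentation (hT1 : ∀ w, T w * Tinv w = 1)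
    (hTiv : ∀ w (u : GL (Fin (2 + 2)) ℂ), u ∈ UnitaryGroup.archLocal L (2 + 2) (hermD L e dV hdV dW hdW) w →
      K2LiuSiegelUnipotentLocalDefs.IsUnipM (n := 2) (u : Matrix (Fin (2 + 2)) (Fin (2 + 2)) ℂ) →
        ∃ b : Matrix (Fin 2) (Fin 2) ℂ, bᴴ = b ∧ T w * Matrix.reindex (e₂ (n := 2)).symm (e₂ (n := 2)).symm (u : Matrix _ _ ℂ) * Tinv w = fromBlocks 1 b 0 1)
    (hTN : ∀ w (b : Matrix (Fin 2) (Fin 2) ℂ), bᴴ = b → ∃ u : GL (Fin (2 + 2)) ℂ,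
      u ∈ UnitaryGroup.archLocal L (2 + 2) (hermD L e dV hdV dW hdW) w ∧ K2LiuSiegelUnipotentLocalDefs.IsUnipM (n := 2) (u : Matrix (Fin (2 + 2)) (Fin (2 + 2)) ℂ) ∧
        T w * Matrix.reindex (e₂ (n := 2)).symm (e₂ (n := 2)).symm (u : Matrix _ _ ℂ) * Tinv w = fromBlocks 1 b 0 1)
    (ν : Measure ↥(unipDeltaArch L e dV hdV dW hdW)) [ν.IsHaarMeasure]
    (B C : {w : InfinitePlace L // w.IsComplex} → Matrix (Fin 2) (Fin 2) ℂ) (hBC : ∀ w, T w * fromBlocks 1 0 0 (-1) * Tinv w = fromBlocks 0 (B w) (C w) 0)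
    (k : {w : InfinitePlace L // w.IsComplex} → ℤ)
    (S : Matrix (Fin 2) (Fin 2) L)
    (eb : {w : InfinitePlace L // w.IsComplex} → Matrix (Fin 2) (Fin 2) ℂ → ℂ)
    (heb : ∀ u : ↥(unipDeltaArch L e dV hdV dW hdW),
      (conj (unipDeltaChar L e dV hdV dW hdW S
          (UnitaryGroup.archToAdelic (Fp L) L (IsCMField.complexConj L) (2 + 2) (hermD L e dV hdV dW hdW)
            (u : UnitaryGroup.arch (Fp L) L (IsCMField.complexConj L) (2 + 2) (hermD L e dV hdV dW hdW))) : ℂ)) =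
        ∏ w, eb w (Matrix.toBlocks₁₂ (Fr (u : UnitaryGroup.arch (Fp L) L (IsCMField.complexConj L) (2 + 2) (hermD L e dV hdV dW hdW)) w)))
    (g₀ g : UnitaryGroup.arch (Fp L) L (IsCMField.complexConj L) (2 + 2) (hermD L e dV hdV dW hdW))
    {m : ℕ} (c : Fin m → ℂ) (Q : Fin m → {w : InfinitePlace L // w.IsComplex} → Carrier)
    (s₁ : ℝ) (hs₁ : 1 / 2 ≤ s₁)
    (hW : ∀ r w, ∃ Ew : ℂ → ℂ, DifferentiableOn ℂ Ew {s : ℂ | 0 < s.re} ∧ ∀ s : ℂ, s₁ < s.re →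
      ∀ F : Matrix (Fin 2 ⊕ Fin 2) (Fin 2 ⊕ Fin 2) ℂ → ℂ, IsArchSiegelSection (fun z : ℂ => (conj z / ((‖z‖ : ℝ) : ℂ)) ^ (k w)) s F →
        (∀ (v : Matrix (Fin 2) (Fin 2) ℂ), vᴴ * v = 1 → ∀ hv : v.det ≠ 0,
          F ((2 : ℂ)⁻¹ • fromBlocks (1 + v) (-(I • (1 - v))) (I • (1 - v)) (1 + v) : Matrix (Fin 2 ⊕ Fin 2) (Fin 2 ⊕ Fin 2) ℂ) = evalAt v hv (Q r w)) →
        ∫ x : Fin 2 → Fin 2 → ℝ, F ((fromBlocks 0 (B w) (C w) 0 : Matrix (Fin 2 ⊕ Fin 2) (Fin 2 ⊕ Fin 2) ℂ) * fromBlocks 1 (hermOfReal x) 0 1 * Fr (g₀ * g) w) *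
          eb w (hermOfReal x) = Ew s)
    (Φ : ℂ → UnitaryGroup.arch (Fp L) L (IsCMField.complexConj L) (2 + 2) (hermD L e dV hdV dW hdW) → ℂ)
    (Cst : ℂ → ℂ) (hCst : DifferentiableOn ℂ Cst {s : ℂ | 0 < s.re})
    (Gs : ℂ → Fin m → {w : InfinitePlace L // w.IsComplex} → Matrix (Fin 2 ⊕ Fin 2) (Fin 2 ⊕ Fin 2) ℂ → ℂ)
    (hGs : ∀ s : ℂ, s₁ < s.re → ∀ r w, IsArchSiegelSection (fun z : ℂ => (conj z / ((‖z‖ : ℝ) : ℂ)) ^ (k w)) s (Gs s r w))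
    (hGsQ : ∀ s : ℂ, s₁ < s.re → ∀ r w, ∀ (v : Matrix (Fin 2) (Fin 2) ℂ), vᴴ * v = 1 → ∀ hv : v.det ≠ 0,
      (Gs s r w) ((2 : ℂ)⁻¹ • fromBlocks (1 + v) (-(I • (1 - v))) (I • (1 - v)) (1 + v) : Matrix (Fin 2 ⊕ Fin 2) (Fin 2 ⊕ Fin 2) ℂ) = evalAt v hv (Q r w))
    (hpres : ∀ s : ℂ, s₁ < s.re → ∀ a : UnitaryGroup.arch (Fp L) L (IsCMField.complexConj L) (2 + 2) (hermD L e dV hdV dW hdW),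
      Φ s a = Cst s * ∑ r, c r * ∏ w, Gs s r w (Fr (a * g) w)) :
    ∃ F : ℂ → ℂ, DifferentiableOn ℂ F {s : ℂ | 0 < s.re} ∧ ∀ s : ℂ, s₁ < s.re →
      F s = archWhittakerIntegral L e dV hdV dW hdW ν S Φ g₀ s := by
  -- the weight `Wt u := conj ψ_S(ι_∞ u)`: continuous, unimodular
  set Wt : ↥(unipDeltaArch L e dV hdV dW hdW) → ℂ := fun u =>
    (conj (unipDeltaChar L e dV hdV dW hdW S
        (UnitaryGroup.archToAdelic (Fp L) L (IsCMField.complexConj L) (2 + 2) (hermD L e dV hdV dW hdW)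
          (u : UnitaryGroup.arch (Fp L) L (IsCMField.complexConj L) (2 + 2) (hermD L e dV hdV dW hdW))) : ℂ)) with hWt_def
  have hWtm : AEStronglyMeasurable Wt ν := by
    refine Continuous.aestronglyMeasurable ?_
    exact Complex.continuous_conj.comp ((continuous_unipDeltaChar L e dV hdV dW hdW S).comp
      ((UnitaryGroup.continuous_archToAdelic (Fp L) L (IsCMField.complexConj L) (2 + 2) (hermD L e dV hdV dW hdW)).comp continuous_subtype_val))
  have hWt1 : ∀ u : ↥(unipDeltaArch L e dV hdV dW hdW), ‖Wt u‖ ≤ 1 := fun u => by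
    rw [hWt_def, Complex.norm_conj]
    exact (Circle.norm_coe _).le
  have hWt : ∀ u : ↥(unipDeltaArch L e dV hdV dW hdW),
      Wt u = ∏ w, eb w (Matrix.toBlocks₁₂ (Fr (u : UnitaryGroup.arch (Fp L) L (IsCMField.complexConj L) (2 + 2) (hermD L e dV hdV dW hdW)) w)) :=
    fun u => heb u
  -- per `r`: ★ FILE A §4 at the pure product `Φ_r s a := ∏_w Gs s r w (Fr a w)` and the right factor `g₀ · g`
  have key : ∀ r : Fin m, ∃ E : ℂ → ℂ, DifferentiableOn ℂ E {s : ℂ | 0 < s.re} ∧ ∀ s : ℂ, s₁ < s.re →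
      ∫ u : ↥(unipDeltaArch L e dV hdV dW hdW), Wt u * (fun (s' : ℂ) (a : UnitaryGroup.arch (Fp L) L (IsCMField.complexConj L) (2 + 2) (hermD L e dV hdV dW hdW)) =>
          ∏ w, Gs s' r w (Fr a w)) s
          (UnitaryGroup.archPart (Fp L) L (IsCMField.complexConj L) (2 + 2) (hermD L e dV hdV dW hdW) (weylDelta L e dV hdV dW hdW) *
            (u : UnitaryGroup.arch (Fp L) L (IsCMField.complexConj L) (2 + 2) (hermD L e dV hdV dW hdW)) * (g₀ * g)) ∂ν = E s := fun r =>
    exists_continuation_twisted_of_presentation L e dV hdV dW hdW T Tinv Fr hFr hT2 hT1 hTiv hTN ν B C hBC k (Q r) (g₀ * g) eb Wt hWt s₁ (hW r)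
      (fun s' a => ∏ w, Gs s' r w (Fr a w)) (fun s' w => Gs s' r w) (fun s' hs' w => hGs s' hs' r w) (fun s' hs' w => hGsQ s' hs' r w) (fun _ _ _ => rfl)
  choose E hE hEq using key
  refine ⟨fun s => Cst s * ∑ r, c r * E r s, hCst.mul (DifferentiableOn.fun_sum fun r _ => (differentiableOn_const (c r)).mul (hE r)), fun s hs => ?_⟩
  have hs' : 1 / 2 < s.re := lt_of_le_of_lt hs₁ hs
  -- per-term integrability (★ FILE A §5)
  have hInt : ∀ r : Fin m, Integrable (fun u : ↥(unipDeltaArch L e dV hdV dW hdW) => Wt u * ∏ w, Gs s r w (Fr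
      (UnitaryGroup.archPart (Fp L) L (IsCMField.complexConj L) (2 + 2) (hermD L e dV hdV dW hdW) (weylDelta L e dV hdV dW hdW) *
        (u : UnitaryGroup.arch (Fp L) L (IsCMField.complexConj L) (2 + 2) (hermD L e dV hdV dW hdW)) * (g₀ * g)) w)) ν := fun r =>
    integrable_twisted_prod_unipDeltaArch_of_record L e dV hdV dW hdW T Tinv Fr hFr hT2 hTU hT1 hTiv hTN ν B C hBC k (Q r) (g₀ * g) Wt hWtm hWt1 hs'
      (fun w => Gs s r w) (fun w => hGs s hs r w) (fun w => hGsQ s hs r w)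
  -- the integrand, term by term
  have hfun : (fun a : ↥(unipDeltaArch L e dV hdV dW hdW) => Wt a * Φ s
        (UnitaryGroup.archPart (Fp L) L (IsCMField.complexConj L) (2 + 2) (hermD L e dV hdV dW hdW) (weylDelta L e dV hdV dW hdW) *
          (a : UnitaryGroup.arch (Fp L) L (IsCMField.complexConj L) (2 + 2) (hermD L e dV hdV dW hdW)) * g₀)) =
      fun a => ∑ r, Cst s * c r * (Wt a * ∏ w, Gs s r w (Fr
        (UnitaryGroup.archPart (Fp L) L (IsCMField.complexConj L) (2 + 2) (hermD L e dV hdV dW hdW) (weylDelta L e dV hdV dW hdW) *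
          (a : UnitaryGroup.arch (Fp L) L (IsCMField.complexConj L) (2 + 2) (hermD L e dV hdV dW hdW)) * (g₀ * g)) w)) := by
    funext a
    rw [hpres s hs, ← mul_assoc _ g₀ g, Finset.mul_sum, Finset.mul_sum]
    exact Finset.sum_congr rfl fun r _ => by ring
  show Cst s * ∑ r, c r * E r s = ∫ a, Wt a * Φ s
      (UnitaryGroup.archPart (Fp L) L (IsCMField.complexConj L) (2 + 2) (hermD L e dV hdV dW hdW) (weylDelta L e dV hdV dW hdW) *
        (a : UnitaryGroup.arch (Fp L) L (IsCMField.complexConj L) (2 + 2) (hermD L e dV hdV dW hdW)) * g₀) ∂ν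
  rw [hfun, integral_finsetSum _ fun r _ => (hInt r).const_mul _, Finset.mul_sum]
  refine Finset.sum_congr rfl fun r _ => ?_
  rw [integral_const_mul, hEq r s hs]
  ring

/-! ## §2 The `hex` slot of ★ `K2LiuKindWArchLetterDefs.kindWArchLetter_eq_integral`, verbatim at `n := 2` -/

include hFr hT2 hTU in
/-- **THE `hex` LETTER OF ★ `kindWArchLetter_eq_integral` AT `n := 2`, PAID FOR SUM-PRESENTED ARCHIMEDEAN FACTORS.**  Inputs: the frame letters of record and `hBC` BY VALUE; the
bad set `T₀` and the archimedean carriers `νinf T` (Haar); the archimedean factors `FinfT j S h` (by value, (KW-fac)); and per `(j, S, h)` with `det ↑S ≠ 0` the SUM PRESENTATION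
letter in its weakest (existential) form `hpresW`: weights `k`, a frame reading `eb` of `conj ψ_S(ι_∞ ·)`, a translate `g`, finitely many flat place-products `Gs s r w` with compact
pictures `Q r w`, a scalar `Cst` holomorphic on `{0 < re}`, the per-`(r,w)` twisted Whittaker letters at `Fr (h_∞·g) w` on `{2∕2 < re}`, and the reading
`FinfT j S h s a = Cst s · Σ_r c_r ∏_w Gs s r w (Fr (a·g) w)` on `{2∕2 < re}` (★ FILE 18's three clauses + `hreadArch`).  THEN ★ `kindWArchLetter_eq_integral`'s `hex` VERBATIM (§1 at
`s₁ := 2∕2`, `g₀ := h_∞`). [cite: Shimura1997, §16.4, §18.4] [cite: KudlaRallis1994, §1–§2] [cite: MoeglinWaldspurger1995, II.1.5, IV.1.9] -/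
theorem hex_of_sumPresentation (hT1 : ∀ w, T w * Tinv w = 1)
    (hTiv : ∀ w (u : GL (Fin (2 + 2)) ℂ), u ∈ UnitaryGroup.archLocal L (2 + 2) (hermD L e dV hdV dW hdW) w →
      K2LiuSiegelUnipotentLocalDefs.IsUnipM (n := 2) (u : Matrix (Fin (2 + 2)) (Fin (2 + 2)) ℂ) →
        ∃ b : Matrix (Fin 2) (Fin 2) ℂ, bᴴ = b ∧ T w * Matrix.reindex (e₂ (n := 2)).symm (e₂ (n := 2)).symm (u : Matrix _ _ ℂ) * Tinv w = fromBlocks 1 b 0 1)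
    (hTN : ∀ w (b : Matrix (Fin 2) (Fin 2) ℂ), bᴴ = b → ∃ u : GL (Fin (2 + 2)) ℂ,
      u ∈ UnitaryGroup.archLocal L (2 + 2) (hermD L e dV hdV dW hdW) w ∧ K2LiuSiegelUnipotentLocalDefs.IsUnipM (n := 2) (u : Matrix (Fin (2 + 2)) (Fin (2 + 2)) ℂ) ∧
        T w * Matrix.reindex (e₂ (n := 2)).symm (e₂ (n := 2)).symm (u : Matrix _ _ ℂ) * Tinv w = fromBlocks 1 b 0 1)
    (B C : {w : InfinitePlace L // w.IsComplex} → Matrix (Fin 2) (Fin 2) ℂ) (hBC : ∀ w, T w * fromBlocks 1 0 0 (-1) * Tinv w = fromBlocks 0 (B w) (C w) 0)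
    (T₀ : Finset (HeightOneSpectrum (𝓞 (Fp L))))
    (νinf : Finset (HeightOneSpectrum (𝓞 (Fp L))) → Measure ↥(unipDeltaArch L e dV hdV dW hdW)) [∀ T' : Finset (HeightOneSpectrum (𝓞 (Fp L))), (νinf T').IsHaarMeasure]
    {m : ℕ}
    (FinfT : Fin m → skewMatrices ((IsCMField.complexConj L : L ≃ₐ[Fp L] L) : L →+* L) ((gramR L e dV hdV dW hdW).map (algebraMap (Fp L) L)) →
      HA L e dV hdV dW hdW → ℂ → UnitaryGroup.arch (Fp L) L (IsCMField.complexConj L) (2 + 2) (hermD L e dV hdV dW hdW) → ℂ)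
    (hpresW : ∀ (j : Fin m) (S : skewMatrices ((IsCMField.complexConj L : L ≃ₐ[Fp L] L) : L →+* L) ((gramR L e dV hdV dW hdW).map (algebraMap (Fp L) L)))
      (h : HA L e dV hdV dW hdW), (S : Matrix (Fin 2) (Fin 2) L).det ≠ 0 →
      ∃ (k : {w : InfinitePlace L // w.IsComplex} → ℤ) (eb : {w : InfinitePlace L // w.IsComplex} → Matrix (Fin 2) (Fin 2) ℂ → ℂ)
        (g : UnitaryGroup.arch (Fp L) L (IsCMField.complexConj L) (2 + 2) (hermD L e dV hdV dW hdW))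
        (mr : ℕ) (c : Fin mr → ℂ) (Q : Fin mr → {w : InfinitePlace L // w.IsComplex} → Carrier) (Cst : ℂ → ℂ)
        (Gs : ℂ → Fin mr → {w : InfinitePlace L // w.IsComplex} → Matrix (Fin 2 ⊕ Fin 2) (Fin 2 ⊕ Fin 2) ℂ → ℂ),
        (∀ u : ↥(unipDeltaArch L e dV hdV dW hdW),
          (conj (unipDeltaChar L e dV hdV dW hdW (S : Matrix (Fin 2) (Fin 2) L)
              (UnitaryGroup.archToAdelic (Fp L) L (IsCMField.complexConj L) (2 + 2) (hermD L e dV hdV dW hdW)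
                (u : UnitaryGroup.arch (Fp L) L (IsCMField.complexConj L) (2 + 2) (hermD L e dV hdV dW hdW))) : ℂ)) =
            ∏ w, eb w (Matrix.toBlocks₁₂ (Fr (u : UnitaryGroup.arch (Fp L) L (IsCMField.complexConj L) (2 + 2) (hermD L e dV hdV dW hdW)) w))) ∧
        (∀ r w, ∃ Ew : ℂ → ℂ, DifferentiableOn ℂ Ew {s : ℂ | 0 < s.re} ∧ ∀ s : ℂ, ((2 : ℕ) : ℝ) / 2 < s.re →
          ∀ F : Matrix (Fin 2 ⊕ Fin 2) (Fin 2 ⊕ Fin 2) ℂ → ℂ, IsArchSiegelSection (fun z : ℂ => (conj z / ((‖z‖ : ℝ) : ℂ)) ^ (k w)) s F →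
            (∀ (v : Matrix (Fin 2) (Fin 2) ℂ), vᴴ * v = 1 → ∀ hv : v.det ≠ 0,
              F ((2 : ℂ)⁻¹ • fromBlocks (1 + v) (-(I • (1 - v))) (I • (1 - v)) (1 + v) : Matrix (Fin 2 ⊕ Fin 2) (Fin 2 ⊕ Fin 2) ℂ) = evalAt v hv (Q r w)) →
            ∫ x : Fin 2 → Fin 2 → ℝ, F ((fromBlocks 0 (B w) (C w) 0 : Matrix (Fin 2 ⊕ Fin 2) (Fin 2 ⊕ Fin 2) ℂ) * fromBlocks 1 (hermOfReal x) 0 1 *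
                Fr (UnitaryGroup.archPart (Fp L) L (IsCMField.complexConj L) (2 + 2) (hermD L e dV hdV dW hdW) h * g) w) *
              eb w (hermOfReal x) = Ew s) ∧
        DifferentiableOn ℂ Cst {s : ℂ | 0 < s.re} ∧
        (∀ s : ℂ, ((2 : ℕ) : ℝ) / 2 < s.re → ∀ r w, IsArchSiegelSection (fun z : ℂ => (conj z / ((‖z‖ : ℝ) : ℂ)) ^ (k w)) s (Gs s r w)) ∧
        (∀ s : ℂ, ((2 : ℕ) : ℝ) / 2 < s.re → ∀ r w, ∀ (v : Matrix (Fin 2) (Fin 2) ℂ), vᴴ * v = 1 → ∀ hv : v.det ≠ 0,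
          (Gs s r w) ((2 : ℂ)⁻¹ • fromBlocks (1 + v) (-(I • (1 - v))) (I • (1 - v)) (1 + v) : Matrix (Fin 2 ⊕ Fin 2) (Fin 2 ⊕ Fin 2) ℂ) = evalAt v hv (Q r w)) ∧
        (∀ s : ℂ, ((2 : ℕ) : ℝ) / 2 < s.re → ∀ a : UnitaryGroup.arch (Fp L) L (IsCMField.complexConj L) (2 + 2) (hermD L e dV hdV dW hdW),
          FinfT j S h s a = Cst s * ∑ r, c r * ∏ w, Gs s r w (Fr (a * g) w))) :
    ∀ (j : Fin m) (S : skewMatrices ((IsCMField.complexConj L : L ≃ₐ[Fp L] L) : L →+* L) ((gramR L e dV hdV dW hdW).map (algebraMap (Fp L) L)))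
      (h : HA L e dV hdV dW hdW), (S : Matrix (Fin 2) (Fin 2) L).det ≠ 0 →
      ∃ F : ℂ → ℂ, DifferentiableOn ℂ F {s : ℂ | 0 < s.re} ∧ ∀ s : ℂ, ((2 : ℕ) : ℝ) / 2 < s.re → F s =
        archWhittakerIntegral L e dV hdV dW hdW (νinf (kindWFinset L e dV hdV dW hdW T₀ (S : Matrix (Fin 2) (Fin 2) L) h)) (S : Matrix (Fin 2) (Fin 2) L)
          (FinfT j S h) (UnitaryGroup.archPart (Fp L) L (IsCMField.complexConj L) (2 + 2) (hermD L e dV hdV dW hdW) h) s := by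
  intro j S h hdet
  obtain ⟨k, eb, g, mr, c, Q, Cst, Gs, heb, hW, hCst, hGs, hGsQ, hpres⟩ := hpresW j S h hdet
  have hs₁ : (1 : ℝ) / 2 ≤ ((2 : ℕ) : ℝ) / 2 := by norm_num
  exact exists_continuation_archWhittakerIntegral_of_sumPresentation L e dV hdV dW hdW T Tinv Fr hFr hT2 hTU hT1 hTiv hTN
    (νinf (kindWFinset L e dV hdV dW hdW T₀ (S : Matrix (Fin 2) (Fin 2) L) h)) B C hBC k (S : Matrix (Fin 2) (Fin 2) L) eb heb
    (UnitaryGroup.archPart (Fp L) L (IsCMField.complexConj L) (2 + 2) (hermD L e dV hdV dW hdW) h) g c Q (((2 : ℕ) : ℝ) / 2) hs₁ hW (FinfT j S h) Cst hCst Gs hGs hGsQ hpres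

end Summit.HodgeConjecture.HodgeConjecture.Cruxes.HLiu418.K2LiuKindWArchContinuationBridge

end
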